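import Mathlib
import HarnessLib
import Literature.Computability.AlgebraicComplexity.PatternExpressions
import Summits.ValiantsHypothesis.ValiantsHypothesis.Theorems.MonotoneRestorationQP.Negative.LoadBearing

/-!
# Route MonotoneRestoration — aside `OrbitCompressionQP` (stmt-ValiantsHypothesis-18332), line
# `expression_compression`: Stub 2 is FALSE WITHOUT `VP` (its `IsVPFamily` hypothesis is load-bearing)

`stub_narrowExpressionCompression` of `Cruxes/OrbitCompressionQP/Lines/expression_compression.lean` asks: a
matrix-symmetric `VP` family presented, at every `n ≥ 1`, by a closed labelled pattern expression with
`n^{k+l} ≤ 2^{(log₂ n + c)^c}` labels (any length) is presented by such expressions of LENGTH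
`≤ 2^{(log₂ n + c)^c}`.  The line card asserts that the `VP` hypothesis is load-bearing "by the counting behind
`OrbitCompressionFalseWithoutVP`"; this file certifies it in the stub's own currency, by degree rather than
counting:

* `totalDegree_value_le` / `totalDegree_close_le` — a pattern expression of length `|e|` has closed
  polynomial of total degree `≤ |e|`;
* `exists_value_eq_pow` / `exists_close_eq_pow` — `(Σ_ij x_ij)^N` is, for every `N` and every `n ≥ 1`, the
  closed polynomial of an expression with ONE row and ONE column label (`n^{1+1} ≤ 2^{(log₂ n + 2)^2}`);
* `not_narrowExpressionCompression_without_VP` — **Stub 2 with `IsVPFamily f` deleted is false**: witness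
  `f n = (Σ_ij x_ij)^{2^{2^n}}`, whose degree exceeds every quasi-polynomial length bound.

Helper file (`--supports stmt-ValiantsHypothesis-18332`); def-free; nothing here is a named fact.
-/

noncomputable section

-- `Summit.ValiantsHypothesis.ValiantsHypothesis.…` is the tree's single-conjunct layout (Sub = Summit).
set_option linter.dupNamespace false

namespace Summit.ValiantsHypothesis.ValiantsHypothesis.Theorems

namespace NarrowCompression

open Literature.Computability.AlgebraicComplexity MvPolynomial

variable {k l : ℕ}

/-! ### Degree is bounded by length -/

/-- **The value of a pattern expression has total degree at most its length.** [folklore] -/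
theorem totalDegree_value_le (n : ℕ) (e : PatternExpr ℂ k l) :
    ∀ (ρ : Fin k → Fin n) (γ : Fin l → Fin n), (e.value n ρ γ).totalDegree ≤ e.length := by
  induction e with
  | edge a b => intro ρ γ; simp [PatternExpr.length]
  | const c => intro ρ γ; simp [PatternExpr.length]
  | add e₁ e₂ ih₁ ih₂ =>
    intro ρ γ
    simp only [PatternExpr.value_add, PatternExpr.length]
    refine (totalDegree_add _ _).trans (max_le ?_ ?_)
    · exact (ih₁ ρ γ).trans (by omega)
    · exact (ih₂ ρ γ).trans (by omega)
  | mul e₁ e₂ ih₁ ih₂ =>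
    intro ρ γ
    simp only [PatternExpr.value_mul, PatternExpr.length]
    exact (totalDegree_mul _ _).trans ((Nat.add_le_add (ih₁ ρ γ) (ih₂ ρ γ)).trans (Nat.le_succ _))
  | sumRow a e ih =>
    intro ρ γ
    simp only [PatternExpr.value_sumRow, PatternExpr.length]
    exact (totalDegree_finsetSum _ _).trans
      (Finset.sup_le fun v _ => (ih _ _).trans (Nat.le_succ _))
  | sumCol b e ih =>
    intro ρ γ
    simp only [PatternExpr.value_sumCol, PatternExpr.length]
    exact (totalDegree_finsetSum _ _).trans
      (Finset.sup_le fun v _ => (ih _ _).trans (Nat.le_succ _))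

/-- **The closed polynomial of a pattern expression has total degree at most its length.** [folklore] -/
theorem totalDegree_close_le (n : ℕ) (e : PatternExpr ℂ k l) : (e.close n).totalDegree ≤ e.length :=
  (totalDegree_finsetSum _ _).trans (Finset.sup_le fun ρ _ =>
    (totalDegree_finsetSum _ _).trans (Finset.sup_le fun γ _ => totalDegree_value_le n e ρ γ))

/-! ### The witness: powers of the total sum as one-label expressions -/

/-- The expression `Σ_a Σ_b x_{ab}` with one row and one column label (both summed out) has value
`Σ_ij x_ij` at every assignment. [folklore] -/
theorem value_totalSum (n : ℕ) (ρ : Fin 1 → Fin n) (γ : Fin 1 → Fin n) :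
    (PatternExpr.sumRow 0 (PatternExpr.sumCol 0 (PatternExpr.edge 0 0)) : PatternExpr ℂ 1 1).value n ρ γ =
      ∑ p : Fin n × Fin n, X p := by
  simp only [PatternExpr.value_sumRow, PatternExpr.value_sumCol, PatternExpr.value_edge,
    Function.update_self]
  exact (Fintype.sum_prod_type fun p : Fin n × Fin n => (X p : MvPolynomial (Fin n × Fin n) ℂ)).symm

/-- **`(Σ_ij x_ij)^N` is the value of a one-row-one-column-label expression** (an `N`-fold product).
[folklore] -/
theorem exists_value_eq_pow (n N : ℕ) : ∃ e : PatternExpr ℂ 1 1,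
    ∀ (ρ : Fin 1 → Fin n) (γ : Fin 1 → Fin n), e.value n ρ γ = (∑ p : Fin n × Fin n, X p) ^ N := by
  induction N with
  | zero => exact ⟨PatternExpr.const 1, fun ρ γ => by simp⟩
  | succ N ih =>
    obtain ⟨e, he⟩ := ih
    refine ⟨PatternExpr.mul e (PatternExpr.sumRow 0 (PatternExpr.sumCol 0 (PatternExpr.edge 0 0))),
      fun ρ γ => ?_⟩
    rw [PatternExpr.value_mul, he, value_totalSum, pow_succ]

/-- **`(Σ_ij x_ij)^N` is the CLOSED polynomial of a one-row-one-column-label expression** (`1 ≤ n`; the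
`n²` assignments are compensated by the constant `n⁻²`). [folklore] -/
theorem exists_close_eq_pow (n N : ℕ) (hn : 1 ≤ n) : ∃ e : PatternExpr ℂ 1 1,
    e.close n = (∑ p : Fin n × Fin n, X p) ^ N := by
  obtain ⟨e, he⟩ := exists_value_eq_pow n N
  refine ⟨PatternExpr.mul (PatternExpr.const (((n : ℂ) * n)⁻¹)) e, ?_⟩
  have hn0 : (n : ℂ) * n ≠ 0 := by
    have : (n : ℂ) ≠ 0 := by exact_mod_cast (show n ≠ 0 by omega)
    exact mul_ne_zero this this
  simp only [PatternExpr.close, PatternExpr.value_mul, PatternExpr.value_const, he, Finset.sum_const,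
    Finset.card_univ, Fintype.card_fun, Fintype.card_fin, pow_one, smul_smul]
  rw [nsmul_eq_mul, ← mul_assoc, Nat.cast_mul, ← C_eq_coe_nat, ← map_mul, ← map_mul,
    mul_inv_cancel₀ hn0, map_one, one_mul]

/-- The witness family is matrix-symmetric. [folklore] -/
theorem rename_perm_pow (n N : ℕ) (σ τ : Equiv.Perm (Fin n)) :
    rename (fun p : Fin n × Fin n => (σ p.1, τ p.2)) ((∑ p : Fin n × Fin n, X p) ^ N : MvPolynomial _ ℂ) =
      (∑ p : Fin n × Fin n, X p) ^ N := by
  simp only [map_pow, map_sum, rename_X]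
  congr 1
  exact Equiv.sum_comp (Equiv.prodCongr σ τ) (fun p : Fin n × Fin n => (X p : MvPolynomial _ ℂ))

/-- The witness has degree `N` (`1 ≤ n`). [folklore] -/
theorem totalDegree_pow (n N : ℕ) (hn : 1 ≤ n) :
    ((∑ p : Fin n × Fin n, X p) ^ N : MvPolynomial _ ℂ).totalDegree = N := by
  have hhom : ((∑ p : Fin n × Fin n, X p) ^ N : MvPolynomial _ ℂ).IsHomogeneous N := by
    have h1 : (∑ p : Fin n × Fin n, (X p : MvPolynomial (Fin n × Fin n) ℂ)).IsHomogeneous 1 :=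
      IsHomogeneous.sum _ _ _ fun p _ => isHomogeneous_X ℂ p
    simpa using h1.pow N
  refine hhom.totalDegree fun h0 => ?_
  have h1 := congrArg (MvPolynomial.eval fun _ : Fin n × Fin n => (1 : ℂ)) h0
  simp only [map_pow, map_sum, MvPolynomial.eval_X, Finset.sum_const, Finset.card_univ,
    Fintype.card_prod, Fintype.card_fin, nsmul_eq_mul, mul_one, map_zero, pow_eq_zero_iff',
    Nat.cast_eq_zero, mul_eq_zero, or_self] at h1
  omega

/-- `n² ≤ 2^{(log₂ n + 2)^2}`. [folklore] -/
theorem sq_le_qp (n : ℕ) : n ^ (1 + 1) ≤ 2 ^ ((Nat.log 2 n + 2) ^ 2) := by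
  have hn : n < 2 ^ (Nat.log 2 n + 1) := Nat.lt_pow_succ_log_self one_lt_two n
  have h1 : n * n ≤ 2 ^ (Nat.log 2 n + 1) * 2 ^ (Nat.log 2 n + 1) := Nat.mul_le_mul hn.le hn.le
  have h2 : 2 ^ (Nat.log 2 n + 1) * 2 ^ (Nat.log 2 n + 1) ≤ 2 ^ ((Nat.log 2 n + 2) ^ 2) := by
    rw [← pow_add]
    exact Nat.pow_le_pow_right two_pos (by nlinarith)
  rw [show 1 + 1 = 2 from rfl, pow_two]
  exact h1.trans h2

/-! ### Stub 2 is false without `VP` -/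

/-- **`stub_narrowExpressionCompression` WITHOUT ITS `IsVPFamily` HYPOTHESIS IS FALSE** (the hypothesis is
load-bearing, as the line card asserts).  Witness `f n = (Σ_ij x_ij)^{2^{2^n}}`: matrix-symmetric
(`rename_perm_pow`), the closed polynomial of a one-row-one-column-label expression at every `n ≥ 1`
(`exists_close_eq_pow`, `n² ≤ 2^{(log₂ n + 2)^2}`), but of total degree `2^{2^n}`, whereas a closed
expression of length `≤ 2^{(log₂ n + c)^c}` has degree `≤ 2^{(log₂ n + c)^c} < 2^{2^n}` for large `n`
(`totalDegree_close_le`, `Negative.polylog_pow_lt_linear`). [folklore] -/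
theorem not_narrowExpressionCompression_without_VP :
    ¬ (∀ f : (n : ℕ) → MvPolynomial (Fin n × Fin n) ℂ,
      (∀ (n : ℕ) (σ τ : Equiv.Perm (Fin n)),
        MvPolynomial.rename (fun p : Fin n × Fin n => (σ p.1, τ p.2)) (f n) = f n) →
      (∃ c : ℕ, ∀ n : ℕ, 1 ≤ n → ∃ (k l : ℕ) (e : PatternExpr ℂ k l),
        n ^ (k + l) ≤ 2 ^ ((Nat.log 2 n + c) ^ c) ∧ e.close n = f n) →
      ∃ c : ℕ, ∀ n : ℕ, 1 ≤ n → ∃ (k l : ℕ) (e : PatternExpr ℂ k l),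
        n ^ (k + l) ≤ 2 ^ ((Nat.log 2 n + c) ^ c) ∧ e.length ≤ 2 ^ ((Nat.log 2 n + c) ^ c) ∧
        e.close n = f n) := by
  intro h
  set f : (n : ℕ) → MvPolynomial (Fin n × Fin n) ℂ :=
    fun n => (∑ p : Fin n × Fin n, X p) ^ (2 ^ (2 ^ n)) with hf
  have hnarrow : ∃ c : ℕ, ∀ n : ℕ, 1 ≤ n → ∃ (k l : ℕ) (e : PatternExpr ℂ k l),
      n ^ (k + l) ≤ 2 ^ ((Nat.log 2 n + c) ^ c) ∧ e.close n = f n := by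
    refine ⟨2, fun n hn => ?_⟩
    obtain ⟨e, he⟩ := exists_close_eq_pow n (2 ^ (2 ^ n)) hn
    exact ⟨1, 1, e, sq_le_qp n, he⟩
  obtain ⟨c, hc⟩ := h f (fun n σ τ => rename_perm_pow n _ σ τ) hnarrow
  -- a large `n`: `(log₂ n + c)^c < n`
  obtain ⟨n₀, hn₀⟩ := MonotoneRestorationQP.Negative.polylog_pow_lt_linear c (δ := 1) one_pos
  obtain ⟨n, hn₀n, h1n⟩ : ∃ n : ℕ, n₀ ≤ n ∧ 1 ≤ n := ⟨max n₀ 1, le_max_left _ _, le_max_right _ _⟩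
  obtain ⟨k, l, e, -, hlen, hclose⟩ := hc n h1n
  set E : ℕ := (Nat.log 2 n + c) ^ c with hE
  have hEn : E < n := by
    have hreal := hn₀ n hn₀n
    have : ((E : ℕ) : ℝ) < (n : ℝ) := by push_cast [hE]; linarith
    exact_mod_cast this
  have hdeg := totalDegree_close_le n e
  rw [hclose, hf, totalDegree_pow n _ h1n] at hdeg
  have h2 : 2 ^ (2 ^ n) ≤ 2 ^ E := hdeg.trans hlen
  have h3 : 2 ^ n ≤ E := (Nat.pow_le_pow_iff_right Nat.one_lt_two).1 h2
  have h4 : n < 2 ^ n := Nat.lt_two_pow_self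
  omega

end NarrowCompression

end Summit.ValiantsHypothesis.ValiantsHypothesis.Theorems

end
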